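import Literature.NumberTheory.Automorphic.CompactlySupportedCoinvariants      -- ★ (G1) `compactlySupported`, `finrank_coinvariants_compactlySupported_le`
import Literature.NumberTheory.Automorphic.SmoothIndOpenCellHaarFunctional      -- ★ `coinvariantsMap_injective_of_isLimitOfCompactOpen` (via import), `ParabolicTriple.ker_restrict_eq_ker_comp_subtype`, `isLimitOfCompactOpen_cmBorelTriple_N`
import Literature.NumberTheory.Automorphic.U3LocalBruhatDecompositionProofs     -- ★ `U3LocalBruhatDecomposition_holds` (`U(Φ₃) = B ⊔ B w₀ N` at a non-split place)
import HarnessLib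

/-!
# The open-cell part of the coinvariants of an induced representation: `dim ≤ dim W` by left exactness

Topic `NumberTheory/Automorphic`; namespaces `Representation` (§1–§4, generic) and `Literature.NumberTheory.Automorphic.UnitaryGroup`
(§5, the `U(3)` corollary).  Definitions with bodies (`cellFunMap`, `vanishingOnSubgroup`, `cellFunMapRestrict`) and theorems; no
named fact, no `sorry`, no instance, no notation.  Sequel of ★ `CompactlySupportedCoinvariants` («`H₀(N, C_c^∞(N, W))` is a
quotient of `W`») and of ★ `SmoothIndOpenCellHaarFunctional` (the cell function; `ParabolicTriple.ker_restrict_eq_ker_comp_subtype`).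

Setting (all GENERIC).  `G` a topological group, `P ≤ G` a subgroup, `τ′` a representation of `P` on `W`, `I = Ind_P^G τ′`
(★ `SmoothInd P τ′`, right translation ★ `smoothIndRep`), `N ≤ P` a subgroup, `ρ_N = I|_N` (`(smoothIndRep P τ′).comp N.subtype`),
`w₀ ∈ G`, and the **cell function** of `f ∈ I` along `w₀`: `n ↦ f(w₀ n)` on `N` (`cellFunMap`), an `N`-equivariant map
`I → C^∞(N, W)` (`cellFunMap_apply_smoothIndRep`).  Let `I_open ≤ I|_N` be the functions vanishing on `P`
(`vanishingOnSubgroup`; = `{f : f(1) = 0}`, `mem_vanishingOnSubgroup_iff_toFun_one`).  HYPOTHESES of the main theorem: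
* (Bruhat) `G = P ⊔ P w₀ N`: `∀ g, g ∈ P ∨ ∃ p ∈ P, ∃ n ∈ N, g = p w₀ n` — then `f ↦` cell function is INJECTIVE on `I_open`
  (`eq_zero_of_cellFunMap_eq_zero`);
* (Supp) every `f ∈ I_open` has COMPACTLY SUPPORTED cell function — then it lands in ★ `compactlySupported k N W`;
* `N` is the union of its compact open subgroups (★ `IsLimitOfCompactOpen`), `char k = 0`, `dim W < ∞`.

**Theorem** (`finrank_map_mk_vanishingOnSubgroup_le`): the image `ℓ` of `I_open` in the coinvariants `(I|_N)_N` is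
finite-dimensional with `finrank ℓ ≤ finrank W`.  Proof: `ℓ` is a quotient of `(I_open)_N`; the cell-function map
`I_open ↪ C_c^∞(N, W)` is an injective `N`-map into a smooth representation, so it stays injective on coinvariants (★
`coinvariantsMap_injective_of_isLimitOfCompactOpen`, Bernstein–Zelevinsky left exactness), and `dim C_c^∞(N, W)_N ≤ dim W` (★
`finrank_coinvariants_compactlySupported_le`).  §4 transports the statement to the Jacquet-module spelling
`(t.restrict I).Coinvariants` of a parabolic triple (the two coinvariant kernels coincide, ★ `ParabolicTriple.ker_restrict_eq_ker_comp_subtype`),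
in the shape «any `ℓ` with `x ∈ ℓ ↔ ∃ f, f(1) = 0 ∧ [f] = x`» exported by the closed-cell files
(`finrank_le_of_forall_mem_iff_exists_toFun_one_eq_zero`, `…_normalizedInd` for `i_P^G σ`).  §5 is the `U(3)` COROLLARY at a
non-split place (`UnitaryGroup.finrank_le_one_of_hasCompactSupport_cellFun`): with ★ F1 `U3LocalBruhatDecomposition_holds`
(`G = B ⊔ B w₀ N`, `w₀ = Φ₃`) and ★ `isLimitOfCompactOpen_cmBorelTriple_N`, `dim ℓ ≤ 1` in `r_B i_G(χ)` holds PROVIDED every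
`f ∈ i_G(χ)` with `f(1) = 0` has compactly supported cell function — the one `U(3)`-specific input left (a valuation estimate on
the big cell, [Casselman1995] proof of Prop. 6.3.1), taken as a HYPOTHESIS here.

This is the open-orbit term of the geometric lemma ([BernsteinZelevinsky1977] Thm. 5.2; [Casselman1995] §6.3) as an UPPER
BOUND, for the two-cell situation `G = P ⊔ P w₀ N` (relative rank one); the exponent on `ℓ` is not computed here.  Cell
`hodgecm-mathlib`, F0∕P3 node N1 ★ `U3PrincipalSeriesJacquetFiltration` (clause (α) `dim r_B i_G(χ) = 2` needs `dim ℓ ≤ 1`;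
the closed-cell half `dim (r ⧸ ℓ) ≤ 1` and the characterisation of `ℓ` are Summits-side, the lower bounds are ★
`mk_restrict_cmPrincipalSeries_ne_zero_of_cellFun_eq_indicator`).

## References

* I. N. Bernstein, A. V. Zelevinsky, *Induced representations of reductive `p`-adic groups I*, Ann. Sci. ÉNS 10 (1977),
  Prop. 1.9 (a), Thm. 5.2. [BernsteinZelevinsky1977]
* W. Casselman, *Introduction to the theory of admissible representations of `p`-adic reductive groups* (1995), §6.3,
  Lemma 7.1.1. [Casselman1995]
* I. N. Bernstein, A. V. Zelevinsky, Russian Math. Surveys 31:3 (1976), §2.22–§2.35. [BernsteinZelevinsky1976]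
* J. D. Rogawski, *Automorphic Representations of Unitary Groups in Three Variables* (1990), §12.2 p. 173. [Rogawski1990]
-/

set_option autoImplicit false

noncomputable section

open scoped BigOperators
open Literature.NumberTheory.Automorphic

namespace Representation

section OpenCell

variable {k : Type*} [Field k] {G : Type*} [Group G] [TopologicalSpace G] [IsTopologicalGroup G]
  (P : Subgroup G) {W : Type*} [AddCommGroup W] [Module k W] (τ' : Representation k P W)
  (N : Subgroup G) (hNP : N ≤ P) (w₀ : G)

/-! ## §1 The cell function `n ↦ f(w₀ n)` as an `N`-map `Ind_P^G τ′ → C^∞(N, W)` -/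

/-- **The cell-function map** `f ↦ (n ↦ f(w₀ n))`, `Ind_P^G τ′ → C^∞(N, W) = Ind_{1}^N 𝟙_W`, linear.  The cell function is
right-smooth on `N` because `f` is right-smooth on `G` (its stabiliser meets `N` in an open subgroup of `N`).
[cite: BernsteinZelevinsky1977, Thm. 5.2] [cite: Casselman1995, §6.3] -/
def cellFunMap : SmoothInd P τ' →ₗ[k] SmoothInd (⊥ : Subgroup ↥N) (Representation.trivial k (⊥ : Subgroup ↥N) W) where
  toFun f := by
    refine (⟨⟨fun n : ↥N => f.toFun (w₀ * (n : G)), ?_⟩, ?_⟩ :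
      ↥(smoothInd (⊥ : Subgroup ↥N) (Representation.trivial k (⊥ : Subgroup ↥N) W)).toSubmodule)
    · rw [mem_indFun_iff]
      intro h g
      rw [Subsingleton.elim h 1, Subgroup.coe_one, one_mul, map_one, Module.End.one_apply]
    · -- stabiliser ⊇ N ∩ Stab_G(f), open in `N`
      refine (indFun (⊥ : Subgroup ↥N) (Representation.trivial k (⊥ : Subgroup ↥N) W)).isSmoothVector_of_le
        (K := ((smoothIndRep P τ').stabilizerSubgroup f).comap N.subtype)
        ((isSmooth_smoothInd P τ' f).preimage continuous_subtype_val) fun u hu => ?_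
      rw [mem_stabilizerSubgroup]
      refine Subtype.ext (funext fun n => ?_)
      rw [indFun_apply_apply]
      change f.toFun (w₀ * ((n * u : ↥N) : G)) = f.toFun (w₀ * (n : G))
      have hu' : (u : G) ∈ (smoothIndRep P τ').stabilizerSubgroup f := Subgroup.mem_comap.1 hu
      rw [mem_stabilizerSubgroup] at hu'
      have := congrArg (fun φ : SmoothInd P τ' => φ.toFun (w₀ * (n : G))) hu'
      simpa only [toFun_smoothIndRep_apply, Subgroup.coe_mul, mul_assoc] using this
  map_add' f g := by
    apply SmoothInd.ext
    funext n
    rfl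
  map_smul' c f := by
    apply SmoothInd.ext
    funext n
    rfl

/-- Values of the cell function. [cite: Casselman1995, §6.3] -/
@[simp] theorem toFun_cellFunMap (f : SmoothInd P τ') (n : ↥N) :
    (cellFunMap (k := k) P τ' N w₀ f).toFun n = f.toFun (w₀ * (n : G)) := rfl

/-- **`N`-equivariance of the cell function**: the cell function of `n₀ · f` is the right translate by `n₀` of the cell
function of `f` (`f(w₀ n n₀)` both ways). [cite: BernsteinZelevinsky1977, Thm. 5.2] -/
theorem cellFunMap_apply_smoothIndRep (f : SmoothInd P τ') (n₀ : ↥N) :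
    cellFunMap (k := k) P τ' N w₀ (smoothIndRep P τ' (n₀ : G) f) =
      smoothIndRep (⊥ : Subgroup ↥N) (Representation.trivial k (⊥ : Subgroup ↥N) W) n₀ (cellFunMap P τ' N w₀ f) := by
  apply SmoothInd.ext
  funext n
  rw [toFun_cellFunMap, toFun_smoothIndRep_apply, toFun_smoothIndRep_apply, toFun_cellFunMap, Subgroup.coe_mul, mul_assoc]

/-! ## §2 The functions vanishing on `P` (`I_open`) and injectivity of the cell function under `G = P ⊔ P w₀ N` -/

/-- **`I_open`**: the functions of `Ind_P^G τ′` vanishing on `P`, an `N`-subrepresentation of `I|_N` (indeed `P`-stable).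
[cite: Casselman1995, §6.3] -/
def vanishingOnSubgroup : Subrepresentation ((smoothIndRep P τ').comp N.subtype) where
  toSubmodule :=
    { carrier := {f | ∀ p : G, p ∈ P → f.toFun p = 0}
      zero_mem' := fun p _ => by
        have h := SmoothInd.toFun_smul (H := P) (σ := τ') (0 : k) 0
        rw [zero_smul, zero_smul] at h
        rw [h, Pi.zero_apply]
      add_mem' := fun {f g} hf hg p hp => by rw [SmoothInd.toFun_add, Pi.add_apply, hf p hp, hg p hp, add_zero]
      smul_mem' := fun c f hf p hp => by rw [SmoothInd.toFun_smul, Pi.smul_apply, hf p hp, smul_zero] }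
  apply_mem_toSubmodule n f hf p hp := by
    change (smoothIndRep P τ' (n : G) f).toFun p = 0
    rw [toFun_smoothIndRep_apply]
    exact hf _ (P.mul_mem hp (hNP n.2))

/-- Membership in `I_open`. [cite: Casselman1995, §6.3] -/
theorem mem_vanishingOnSubgroup_iff (f : SmoothInd P τ') :
    f ∈ vanishingOnSubgroup (k := k) P τ' N hNP ↔ ∀ p : G, p ∈ P → f.toFun p = 0 := Iff.rfl

/-- **`I_open = {f : f(1) = 0}`** (`f(p) = τ′(p) f(1)`). [cite: Casselman1995, §6.3] -/
theorem mem_vanishingOnSubgroup_iff_toFun_one (f : SmoothInd P τ') :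
    f ∈ vanishingOnSubgroup (k := k) P τ' N hNP ↔ f.toFun 1 = 0 := by
  rw [mem_vanishingOnSubgroup_iff]
  refine ⟨fun h => h 1 P.one_mem, fun h p hp => ?_⟩
  rw [show p = ((⟨p, hp⟩ : P) : G) * 1 from (mul_one p).symm, SmoothInd.toFun_subgroup_mul, h, map_zero]

/-- **Injectivity of the cell function on `I_open` under the Bruhat hypothesis `G = P ⊔ P w₀ N`**: a function vanishing on
`P` and on `w₀ N` vanishes on `P w₀ N` (`f(p w₀ n) = τ′(p) f(w₀ n)`), hence everywhere. [cite: BernsteinZelevinsky1977, Thm. 5.2]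
[cite: Casselman1995, §6.3] -/
theorem eq_zero_of_cellFunMap_eq_zero (hBruhat : ∀ g : G, g ∈ P ∨ ∃ p ∈ P, ∃ n ∈ N, g = p * w₀ * n)
    {f : SmoothInd P τ'} (hf : f ∈ vanishingOnSubgroup (k := k) P τ' N hNP) (h0 : cellFunMap (k := k) P τ' N w₀ f = 0) :
    f = 0 := by
  have hzero : ∀ n : ↥N, f.toFun (w₀ * (n : G)) = 0 := fun n => by
    have := congrArg (fun φ : SmoothInd (⊥ : Subgroup ↥N) (Representation.trivial k (⊥ : Subgroup ↥N) W) => φ.toFun n) h0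
    rw [toFun_cellFunMap] at this
    rw [this]
    have hz := SmoothInd.toFun_smul (H := (⊥ : Subgroup ↥N)) (σ := Representation.trivial k _ W) (0 : k) 0
    rw [zero_smul, zero_smul] at hz
    rw [hz, Pi.zero_apply]
  apply SmoothInd.ext
  funext g
  have hz : (0 : SmoothInd P τ').toFun g = 0 := by
    have := SmoothInd.toFun_smul (H := P) (σ := τ') (0 : k) 0
    rw [zero_smul, zero_smul] at this
    rw [this, Pi.zero_apply]
  rw [hz]
  rcases hBruhat g with hg | ⟨p, hp, n, hn, rfl⟩
  · exact hf g hg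
  · rw [show p * w₀ * n = ((⟨p, hp⟩ : P) : G) * (w₀ * ((⟨n, hn⟩ : ↥N) : G)) by rw [mul_assoc],
      SmoothInd.toFun_subgroup_mul, hzero, map_zero]

/-! ## §3 Into `C_c^∞(N, W)` and the dimension bound -/

/-- `C_c^∞(N, W)` is a smooth representation of `N` (a subrepresentation of the smooth `C^∞(N, W)`).
[cite: BernsteinZelevinsky1976, §2.22] -/
theorem isSmooth_compactlySupported (N : Type*) [Group N] [TopologicalSpace N] [IsTopologicalGroup N] :
    (compactlySupported k N W).toRepresentation.IsSmooth := by
  intro x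
  refine (compactlySupported k N W).toRepresentation.isSmoothVector_of_le
    (isSmooth_smoothInd (⊥ : Subgroup N) (Representation.trivial k (⊥ : Subgroup N) W) x.1) fun g hg => ?_
  rw [mem_stabilizerSubgroup] at hg ⊢
  exact Subtype.ext hg

variable (hsupp : ∀ f : SmoothInd P τ', f ∈ vanishingOnSubgroup (k := k) P τ' N hNP →
    cellFunMap (k := k) P τ' N w₀ f ∈ compactlySupported k ↥N W)

include hsupp

/-- **The cell-function map `I_open → C_c^∞(N, W)` as an `N`-intertwining map** (under the compact-support hypothesis).
[cite: BernsteinZelevinsky1977, Thm. 5.2] -/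
def cellFunMapRestrict :
    (vanishingOnSubgroup (k := k) P τ' N hNP).toRepresentation.IntertwiningMap (compactlySupported k ↥N W).toRepresentation where
  toLinearMap :=
    { toFun := fun f => ⟨cellFunMap (k := k) P τ' N w₀ f.1, hsupp f.1 f.2⟩
      map_add' := fun f g => Subtype.ext (map_add _ _ _)
      map_smul' := fun c f => Subtype.ext (map_smul _ _ _) }
  isIntertwining' n := by
    apply LinearMap.ext
    intro f
    apply Subtype.ext
    exact cellFunMap_apply_smoothIndRep P τ' N w₀ f.1 n

/-- The underlying function of `cellFunMapRestrict`. [cite: BernsteinZelevinsky1977, Thm. 5.2] -/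
theorem coe_cellFunMapRestrict_apply (f : ↥(vanishingOnSubgroup (k := k) P τ' N hNP).toSubmodule) :
    ((cellFunMapRestrict (k := k) P τ' N hNP w₀ hsupp f : ↥(compactlySupported k ↥N W).toSubmodule) :
      SmoothInd (⊥ : Subgroup ↥N) (Representation.trivial k (⊥ : Subgroup ↥N) W)) = cellFunMap P τ' N w₀ f.1 := rfl

variable [CharZero k]

/-- **`dim (I_open)_N ≤ dim W`**: under (Bruhat) and (Supp), with `N` a union of compact open subgroups and `W`
finite-dimensional, the `N`-coinvariants of `I_open` are finite-dimensional of dimension at most `dim W` (left exactness ★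
`coinvariantsMap_injective_of_isLimitOfCompactOpen` + ★ `finrank_coinvariants_compactlySupported_le`).
[cite: BernsteinZelevinsky1977, Prop. 1.9 (a), Thm. 5.2] [cite: Casselman1995, Lemma 7.1.1 (a)] -/
theorem finrank_coinvariants_vanishingOnSubgroup_le [FiniteDimensional k W] (hN : IsLimitOfCompactOpen ↥N)
    (hBruhat : ∀ g : G, g ∈ P ∨ ∃ p ∈ P, ∃ n ∈ N, g = p * w₀ * n) :
    FiniteDimensional k (vanishingOnSubgroup (k := k) P τ' N hNP).toRepresentation.Coinvariants ∧
      Module.finrank k (vanishingOnSubgroup (k := k) P τ' N hNP).toRepresentation.Coinvariants ≤ Module.finrank k W := by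
  have hinj : Function.Injective (cellFunMapRestrict (k := k) P τ' N hNP w₀ hsupp) := by
    intro f g hfg
    have h := congrArg (fun x : ↥(compactlySupported k ↥N W).toSubmodule =>
      (x : SmoothInd (⊥ : Subgroup ↥N) (Representation.trivial k (⊥ : Subgroup ↥N) W))) hfg
    simp only [coe_cellFunMapRestrict_apply] at h
    have hsub : f.1 - g.1 = 0 := by
      refine eq_zero_of_cellFunMap_eq_zero (k := k) P τ' N hNP w₀ hBruhat
        ((vanishingOnSubgroup (k := k) P τ' N hNP).toSubmodule.sub_mem f.2 g.2) ?_
      rw [map_sub, h, sub_self]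
    exact Subtype.ext (sub_eq_zero.1 hsub)
  have hmapinj := coinvariantsMap_injective_of_isLimitOfCompactOpen hN (isSmooth_compactlySupported (k := k) (W := W) ↥N)
    (cellFunMapRestrict (k := k) P τ' N hNP w₀ hsupp) hinj
  obtain ⟨hfd, hle⟩ := finrank_coinvariants_compactlySupported_le (k := k) (N := ↥N) (W := W) hN
  haveI := hfd
  exact ⟨Module.Finite.of_injective _ hmapinj, (LinearMap.finrank_le_finrank_of_injective hmapinj).trans hle⟩

/-- **The open-cell bound in the coinvariants of `I|_N`**: the image `ℓ` of `I_open` in `(I|_N)_N` — a quotient of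
`(I_open)_N` — is finite-dimensional with `finrank ℓ ≤ finrank W`. [cite: BernsteinZelevinsky1977, Thm. 5.2]
[cite: Casselman1995, Lemma 7.1.1 (a)] -/
theorem finrank_map_mk_vanishingOnSubgroup_le [FiniteDimensional k W] (hN : IsLimitOfCompactOpen ↥N)
    (hBruhat : ∀ g : G, g ∈ P ∨ ∃ p ∈ P, ∃ n ∈ N, g = p * w₀ * n) :
    FiniteDimensional k ↥(((vanishingOnSubgroup (k := k) P τ' N hNP).toSubmodule).map
        (Coinvariants.mk ((smoothIndRep P τ').comp N.subtype))) ∧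
      Module.finrank k ↥(((vanishingOnSubgroup (k := k) P τ' N hNP).toSubmodule).map
        (Coinvariants.mk ((smoothIndRep P τ').comp N.subtype))) ≤ Module.finrank k W := by
  obtain ⟨hfd, hle⟩ := finrank_coinvariants_vanishingOnSubgroup_le (k := k) P τ' N hNP w₀ hsupp hN hBruhat
  haveI := hfd
  -- the inclusion `I_open ↪ I|_N` on coinvariants has range `ℓ`
  let ι : (vanishingOnSubgroup (k := k) P τ' N hNP).toRepresentation.IntertwiningMap ((smoothIndRep P τ').comp N.subtype) :=
    { toLinearMap := (vanishingOnSubgroup (k := k) P τ' N hNP).toSubmodule.subtype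
      isIntertwining' := fun n => rfl }
  have hrange : ((vanishingOnSubgroup (k := k) P τ' N hNP).toSubmodule).map
      (Coinvariants.mk ((smoothIndRep P τ').comp N.subtype)) =
      LinearMap.range (Coinvariants.map _ _ ι) := by
    apply le_antisymm
    · rintro _ ⟨f, hf, rfl⟩
      exact ⟨Coinvariants.mk _ ⟨f, hf⟩, by rw [Coinvariants.map_mk]; rfl⟩
    · rintro _ ⟨x, rfl⟩
      obtain ⟨f, rfl⟩ := Coinvariants.mk_surjective _ x
      exact ⟨f.1, f.2, by rw [Coinvariants.map_mk]; rfl⟩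
  rw [hrange]
  exact ⟨inferInstance, (LinearMap.finrank_range_le _).trans hle⟩

end OpenCell

/-! ## §4 The Jacquet-module spelling: parabolic triples -/

section Jacquet

variable {G : Type*} [Group G] [TopologicalSpace G] [IsTopologicalGroup G]
  (t : ParabolicTriple G) {W : Type*} [AddCommGroup W] [Module ℂ W]

/-- **THE OPEN-CELL BOUND IN THE JACQUET MODULE** of `I = Ind_P^G τ′` for a parabolic triple `t = (P, M, N)` and `w₀ ∈ G` with
`G = P ⊔ P w₀ N`: every subspace `ℓ ≤ (t.restrict I).Coinvariants` consisting exactly of the classes of the functions vanishing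
at `1` (the shape exported by the closed-cell lemma) is finite-dimensional with `finrank ℓ ≤ finrank W`, PROVIDED every such
function has compactly supported cell function `n ↦ f(w₀ n)` on `N` and `N` is a union of compact open subgroups.  (The two
coinvariant kernels — through `N ≤ P` and through `N ≤ G` — coincide: ★ `ParabolicTriple.ker_restrict_eq_ker_comp_subtype`.)
[cite: BernsteinZelevinsky1977, Prop. 1.9 (a), Thm. 5.2] [cite: Casselman1995, Lemma 7.1.1 (a); §6.3] -/
theorem finrank_le_of_forall_mem_iff_exists_toFun_one_eq_zero [FiniteDimensional ℂ W] (τ' : Representation ℂ t.P W) (w₀ : G)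
    (hN : IsLimitOfCompactOpen ↥t.N) (hBruhat : ∀ g : G, g ∈ t.P ∨ ∃ p ∈ t.P, ∃ n ∈ t.N, g = p * w₀ * n)
    (hsupp : ∀ f : SmoothInd t.P τ', f.toFun 1 = 0 → HasCompactSupport fun n : ↥t.N => f.toFun (w₀ * (n : G)))
    (ℓ : Submodule ℂ (t.restrict (smoothIndRep t.P τ')).Coinvariants)
    (hℓ : ∀ x, x ∈ ℓ ↔ ∃ f : SmoothInd t.P τ', f.toFun 1 = 0 ∧ Coinvariants.mk _ f = x) :
    FiniteDimensional ℂ ↥ℓ ∧ Module.finrank ℂ ↥ℓ ≤ Module.finrank ℂ W := by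
  -- (Supp) in the `vanishingOnSubgroup` / `compactlySupported` spelling
  have hsupp' : ∀ f : SmoothInd t.P τ', f ∈ vanishingOnSubgroup (k := ℂ) t.P τ' t.N t.N_le →
      cellFunMap (k := ℂ) t.P τ' t.N w₀ f ∈ compactlySupported ℂ ↥t.N W := fun f hf => by
    have h := hsupp f ((mem_vanishingOnSubgroup_iff_toFun_one t.P τ' t.N t.N_le f).1 hf)
    exact ⟨tsupport fun n : ↥t.N => f.toFun (w₀ * (n : G)), h.isCompact, fun n hn => by
      rw [toFun_cellFunMap]; exact image_eq_zero_of_notMem_tsupport (f := fun m : ↥t.N => f.toFun (w₀ * (m : G))) hn⟩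
  obtain ⟨hfd, hle⟩ := finrank_map_mk_vanishingOnSubgroup_le (k := ℂ) t.P τ' t.N t.N_le w₀ hsupp' hN hBruhat
  haveI := hfd
  -- `(t.restrict I).Coinvariants` and `(I|_N).Coinvariants` are the same quotient of `I`
  have hker := t.ker_restrict_eq_ker_comp_subtype (smoothIndRep t.P τ')
  let e : (t.restrict (smoothIndRep t.P τ')).Coinvariants ≃ₗ[ℂ] Coinvariants ((smoothIndRep t.P τ').comp t.N.subtype) :=
    Submodule.quotEquivOfEq _ _ hker
  have he : ∀ f : SmoothInd t.P τ', e (Coinvariants.mk _ f) = Coinvariants.mk _ f := fun f => rfl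
  -- `e` maps `ℓ` onto the image of `I_open`
  have hmap : ℓ.map (e : (t.restrict (smoothIndRep t.P τ')).Coinvariants →ₗ[ℂ] _) =
      ((vanishingOnSubgroup (k := ℂ) t.P τ' t.N t.N_le).toSubmodule).map
        (Coinvariants.mk ((smoothIndRep t.P τ').comp t.N.subtype)) := by
    apply le_antisymm
    · rintro _ ⟨x, hx, rfl⟩
      obtain ⟨f, hf1, rfl⟩ := (hℓ x).1 hx
      exact ⟨f, (mem_vanishingOnSubgroup_iff_toFun_one t.P τ' t.N t.N_le f).2 hf1, (he f).symm⟩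
    · rintro _ ⟨f, hf, rfl⟩
      refine ⟨Coinvariants.mk _ f, (hℓ _).2 ⟨f, (mem_vanishingOnSubgroup_iff_toFun_one t.P τ' t.N t.N_le f).1 hf, rfl⟩, he f⟩
  have eℓ : ↥ℓ ≃ₗ[ℂ] ↥(((vanishingOnSubgroup (k := ℂ) t.P τ' t.N t.N_le).toSubmodule).map
      (Coinvariants.mk ((smoothIndRep t.P τ').comp t.N.subtype))) :=
    (Submodule.equivMapOfInjective _ e.injective ℓ).trans (LinearEquiv.ofEq _ _ hmap)
  exact ⟨Module.Finite.equiv eℓ.symm, by rw [LinearEquiv.finrank_eq eℓ]; exact hle⟩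

/-- **The same bound for NORMALISED induction `i_P^G σ = Ind_P^G (σ ∘ proj ⊗ δ_P^{1/2})`** (★ `normalizedInd`; the carrier of ★
`normalizedJacquet`): `finrank ℓ ≤ finrank W` for the subspace `ℓ ≤ r_P(i_P^G σ)` of classes of functions vanishing at `1`.
[cite: BernsteinZelevinsky1977, Prop. 1.9 (a), Thm. 5.2] [cite: Casselman1995, Lemma 7.1.1 (a); §6.3] -/
theorem finrank_le_of_forall_mem_iff_exists_toFun_one_eq_zero_normalizedInd [LocallyCompactSpace ↥t.P] [FiniteDimensional ℂ W]
    (σ : Representation ℂ t.M W) (w₀ : G)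
    (hN : IsLimitOfCompactOpen ↥t.N) (hBruhat : ∀ g : G, g ∈ t.P ∨ ∃ p ∈ t.P, ∃ n ∈ t.N, g = p * w₀ * n)
    (hsupp : ∀ f : SmoothInd t.P (Representation.twist (σ.comp t.proj) (rootDeltaChar t.P)),
      f.toFun 1 = 0 → HasCompactSupport fun n : ↥t.N => f.toFun (w₀ * (n : G)))
    (ℓ : Submodule ℂ (t.restrict (normalizedInd t σ)).Coinvariants)
    (hℓ : ∀ x, x ∈ ℓ ↔ ∃ f : SmoothInd t.P (Representation.twist (σ.comp t.proj) (rootDeltaChar t.P)),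
      f.toFun 1 = 0 ∧ Coinvariants.mk _ f = x) :
    FiniteDimensional ℂ ↥ℓ ∧ Module.finrank ℂ ↥ℓ ≤ Module.finrank ℂ W :=
  finrank_le_of_forall_mem_iff_exists_toFun_one_eq_zero t (Representation.twist (σ.comp t.proj) (rootDeltaChar t.P)) w₀ hN
    hBruhat hsupp ℓ hℓ

end Jacquet

end Representation

/-! ## §5 `U(3)` at a non-split place: `dim ℓ ≤ 1` modulo the compact support of the cell functions -/

namespace Literature.NumberTheory.Automorphic.UnitaryGroup

open _root_.NumberField _root_.IsDedekindDomain
open scoped MatrixGroups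

variable (L : Type) [Field L] [NumberField L] [IsCMField L]

set_option synthInstance.maxHeartbeats 400000 in  -- instance paths on the CM carrier `∏_{w ∣ v} L_w` (as in ★ N1 itself)
set_option maxHeartbeats 2000000 in
/-- **OPEN-CELL BOUND FOR `r_B i_G(χ)`, `G = U(Φ₃)(L⁺_v)` AT A NON-SPLIT PLACE, MODULO COMPACT SUPPORT** (node N1 of the F0∕P3
statement tree, clause (α) and the `ℓ`-half of (γ) of ★ `U3PrincipalSeriesJacquetFiltration`): for the subspace `ℓ ≤ r_B i_G(χ)`
of classes of functions vanishing at `1` (the `ℓ` of the closed-cell lemma), `ℓ` is finite-dimensional with `finrank ℓ ≤ 1` —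
PROVIDED, for the Bruhat element `w₀` (`w₀ = Φ₃`, ★ `U3LocalBruhatDecomposition_holds`), every `f ∈ i_G(χ)` with `f(1) = 0`
has compactly supported cell function `n ↦ f(w₀ n)` on `N(L⁺_v)`.  Inputs: `G = B ⊔ B w₀ N` (★ F1), `N` a union of compact open
subgroups (★ `isLimitOfCompactOpen_cmBorelTriple_N`), left exactness of coinvariants, `dim C_c^∞(N)_N ≤ 1`.  Stated for ★
`normalizedInd (cmBorelTriple L 3 v) (𝟙 ⊗ χ)`, which is ★ `cmPrincipalSeries L 3 v χ` definitionally.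
[cite: Casselman1995, Lemma 7.1.1 (a); §6.3; Prop. 1.3.1] [cite: BernsteinZelevinsky1977, Thm. 5.2] [cite: Rogawski1990, §12.2 p. 173] -/
theorem finrank_le_one_of_hasCompactSupport_cellFun (v : HeightOneSpectrum (𝓞 ↥(maximalRealSubfield L)))
    (hns : ∀ w : PlacesOver L v, IsCMField.complexConj L • w.1 = w.1)
    (χ : ↥(torusU (conjLocal L (IsCMField.complexConj L) v) (cmLocalForm L 3 v)) →* ℂˣ)
    (hsupp : haveI := locallyCompactSpace_cmBorelU L 3 v
      ∀ w₀ : ↥(unitaryGroupOfForm (conjLocal L (IsCMField.complexConj L) v) (cmLocalForm L 3 v)),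
      Units.val (w₀ : GL (Fin 3) (LocalRing L v)) = cmLocalForm L 3 v →
      ∀ f : Representation.SmoothInd (cmBorelTriple L 3 v).P
        (Representation.twist
          (((Representation.trivial ℂ ↥(torusU (conjLocal L (IsCMField.complexConj L) v) (cmLocalForm L 3 v)) ℂ).twist
            χ).comp (cmBorelTriple L 3 v).proj) (rootDeltaChar (cmBorelTriple L 3 v).P)),
        f.toFun 1 = 0 → HasCompactSupport fun n : ↥(cmBorelTriple L 3 v).N =>
          f.toFun (w₀ * (n : ↥(unitaryGroupOfForm (conjLocal L (IsCMField.complexConj L) v) (cmLocalForm L 3 v)))))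
    (ℓ : haveI := locallyCompactSpace_cmBorelU L 3 v
      Submodule ℂ ((cmBorelTriple L 3 v).restrict (Representation.normalizedInd (cmBorelTriple L 3 v)
        ((Representation.trivial ℂ ↥(torusU (conjLocal L (IsCMField.complexConj L) v) (cmLocalForm L 3 v)) ℂ).twist χ))).Coinvariants)
    (hℓ : haveI := locallyCompactSpace_cmBorelU L 3 v
      ∀ x, x ∈ ℓ ↔ ∃ f : Representation.SmoothInd (cmBorelTriple L 3 v).P
        (Representation.twist
          (((Representation.trivial ℂ ↥(torusU (conjLocal L (IsCMField.complexConj L) v) (cmLocalForm L 3 v)) ℂ).twist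
            χ).comp (cmBorelTriple L 3 v).proj) (rootDeltaChar (cmBorelTriple L 3 v).P)),
        f.toFun 1 = 0 ∧ Representation.Coinvariants.mk _ f = x) :
    FiniteDimensional ℂ ↥ℓ ∧ Module.finrank ℂ ↥ℓ ≤ 1 := by
  haveI := locallyCompactSpace_cmBorelU L 3 v
  -- (stepwise on purpose: the one-shot `obtain … := U3LocalBruhatDecomposition_holds L v hns` times out at `isDefEq`)
  have H0 := U3LocalBruhatDecomposition_holds L v
  have H1 := H0 hns
  obtain ⟨w₀, hval, -, hBruhat, -⟩ := H1
  have hB : ∀ g : ↥(unitaryGroupOfForm (conjLocal L (IsCMField.complexConj L) v) (cmLocalForm L 3 v)),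
      g ∈ (cmBorelTriple L 3 v).P ∨ ∃ p ∈ (cmBorelTriple L 3 v).P, ∃ n ∈ (cmBorelTriple L 3 v).N, g = p * w₀ * n := hBruhat
  have hS : ∀ f : Representation.SmoothInd (cmBorelTriple L 3 v).P
      (Representation.twist
        ((((Representation.trivial ℂ ↥(torusU (conjLocal L (IsCMField.complexConj L) v) (cmLocalForm L 3 v)) ℂ).twist
          χ)).comp (cmBorelTriple L 3 v).proj) (rootDeltaChar (cmBorelTriple L 3 v).P)),
      f.toFun 1 = 0 → HasCompactSupport fun n : ↥(cmBorelTriple L 3 v).N =>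
        f.toFun (w₀ * (n : ↥(unitaryGroupOfForm (conjLocal L (IsCMField.complexConj L) v) (cmLocalForm L 3 v)))) :=
    hsupp w₀ hval
  have hN := isLimitOfCompactOpen_cmBorelTriple_N L 3 v
  have H := Representation.finrank_le_of_forall_mem_iff_exists_toFun_one_eq_zero_normalizedInd (cmBorelTriple L 3 v)
    ((Representation.trivial ℂ ↥(torusU (conjLocal L (IsCMField.complexConj L) v) (cmLocalForm L 3 v)) ℂ).twist χ) w₀
    hN hB hS ℓ hℓ
  obtain ⟨hfd, hle⟩ := H
  refine ⟨hfd, ?_⟩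
  have h1 : Module.finrank ℂ ℂ = 1 := Module.finrank_self ℂ  -- (`hle.trans h1.le` makes the unifier unfold `finrank`; `omega` atomises)
  omega

end Literature.NumberTheory.Automorphic.UnitaryGroup

end
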